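import Mathlib.RingTheory.Derivation.Basic
import Mathlib.RingTheory.Localization.AsSubring
import Mathlib.Tactic.FieldSimp
import HarnessLib

/-!
# Derivations preserving a domain preserve its localisations inside the fraction field

Route `ResolutionOfSingularities/RadicialJung`, crux `CleanModels` (stmt-ResolutionOfSingularities-15917),
line `via-clean-models` of crux `DescentPerfectToAll` (stmt-ResolutionOfSingularities-0549): brick
K3c-iii(a) of PROGRAMME-clean-dim2 (Giraud's normal form over an ARBITRARY ground field), companion
of `RadicialJungCleanModelsLogDerivationsChart.lean` (Giraud 1983, Rem. 1.6: logarithmic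
derivations preserve the blow-up chart `R[y/x] ⊆ K`). Helper file (`--supports`), OURS; nothing here
is a statement of Hironaka's manuscript.

To pass from the chart ALGEBRA `R[y/x]` to the LOCAL RINGS of the blown-up surface at its points
(localisations of the chart algebra, as subalgebras of the function field `K`), one needs that a
derivation of `K` preserving a domain `A ⊆ K` preserves every localisation `S⁻¹A ⊆ K`
(Mathlib's `Localization.subalgebra.ofField K S hS`): the quotient rule
`D(a/s) = (s·Da − a·Ds)/s²`. Hence the log-Jacobian content ideals of Giraud (values `D f` of
logarithmic derivations, `RadicialJungCleanModelsContentIdeal.lean`) pass to the local rings of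
`X'`: `J(X, f, E) 𝒪_{X',ξ'} ⊆ J(X', f, E')_{ξ'}` (Giraud 1.6 (4)).

* `derivation_apply_mul_inv_mem_ofField` — the quotient rule lands in `S⁻¹A`;
* `derivation_mapsTo_ofField` — a derivation of `K` mapping `A` into `S⁻¹A` (e.g. into `A`) maps
  `S⁻¹A` into itself.

## References
* J. Giraud, *Forme normale d'une fonction sur une surface de caractéristique positive*, Bull. Soc.
  Math. France 111 (1983), Remarque 1.6 (4). [Giraud1983]
-/

noncomputable section

set_option linter.dupNamespace false -- mandated namespace of this single-conjunct summit

namespace Summit.ResolutionOfSingularities.ResolutionOfSingularities.Theorems.RadicialJung.CleanModels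

universe u v

variable {A : Type u} [CommRing A] {K : Type v} [Field K] [Algebra A K]
  [IsFractionRing A K] (S : Submonoid A) (hS : S ≤ nonZeroDivisors A)

/-- Elements `a/s` (`s ∈ S`) lie in `S⁻¹A ⊆ K`. [folklore] -/
theorem algebraMap_mul_inv_mem_ofField (a : A) {s : A} (hs : s ∈ S) :
    algebraMap A K a * (algebraMap A K s)⁻¹ ∈ Localization.subalgebra.ofField K S hS :=
  ⟨a, s, hs, rfl⟩

/-- **Quotient rule inside `S⁻¹A`.** If a derivation `D` of `K` maps `A` into `S⁻¹A`, then
`D (a/s) ∈ S⁻¹A` for `a ∈ A`, `s ∈ S`: `D(a/s) = (Da)/s − a (Ds)/s²`. [folklore] -/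
theorem derivation_apply_mul_inv_mem_ofField (D : Derivation ℤ K K)
    (hD : ∀ a : A, D (algebraMap A K a) ∈ Localization.subalgebra.ofField K S hS)
    (a : A) {s : A} (hs : s ∈ S) :
    D (algebraMap A K a * (algebraMap A K s)⁻¹) ∈ Localization.subalgebra.ofField K S hS := by
  set T := Localization.subalgebra.ofField K S hS
  have hinv : (algebraMap A K s)⁻¹ ∈ T := by
    have := algebraMap_mul_inv_mem_ofField (K := K) S hS 1 hs
    rwa [map_one, one_mul] at this
  -- `D (s⁻¹) = - s⁻¹ ^ 2 • D s`
  have hDinv : D ((algebraMap A K s)⁻¹) ∈ T := by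
    rw [Derivation.leibniz_inv, smul_eq_mul, neg_mul]
    exact T.neg_mem (T.mul_mem (T.pow_mem hinv 2) (hD s))
  rw [Derivation.leibniz, smul_eq_mul, smul_eq_mul]
  exact T.add_mem (T.mul_mem (Subalgebra.algebraMap_mem T a) hDinv) (T.mul_mem hinv (hD a))

/-- **Derivations preserving `A` preserve `S⁻¹A`** (inside the fraction field): if `D` maps `A`
into `S⁻¹A` then `D` maps `S⁻¹A` into itself. Applied to the local rings of the blow-up chart this
carries Giraud's inclusion `J(X, f, E) 𝒪_{X'} ⊆ J(X', f, E')` (Rem. 1.6 (4)) from the chart algebra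
to its localisations. [cite: Giraud1983, Rem. 1.6 (4)] -/
theorem derivation_mapsTo_ofField (D : Derivation ℤ K K)
    (hD : ∀ a : A, D (algebraMap A K a) ∈ Localization.subalgebra.ofField K S hS) :
    ∀ z ∈ Localization.subalgebra.ofField K S hS, D z ∈ Localization.subalgebra.ofField K S hS := by
  rintro z ⟨a, s, hs, rfl⟩
  exact derivation_apply_mul_inv_mem_ofField S hS D hD a hs

/-- Variant with the weaker-looking hypothesis "`D` maps `A` into `A`". [folklore] -/
theorem derivation_mapsTo_ofField_of_forall_exists (D : Derivation ℤ K K)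
    (hD : ∀ a : A, ∃ a' : A, D (algebraMap A K a) = algebraMap A K a') :
    ∀ z ∈ Localization.subalgebra.ofField K S hS, D z ∈ Localization.subalgebra.ofField K S hS := by
  refine derivation_mapsTo_ofField S hS D fun a => ?_
  obtain ⟨a', ha'⟩ := hD a
  rw [ha']
  exact Subalgebra.algebraMap_mem _ a'

end Summit.ResolutionOfSingularities.ResolutionOfSingularities.Theorems.RadicialJung.CleanModels

end
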